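import Summits.CriticalPhenomena.PercolationContinuityZ3.Theorems.PercNearOneGluingNoHeavyPcintBSMRZ5RSCert
import HarnessLib

/-!
# PCINT lane, PHASE 9 (block renewal with reach-3 pieces): kernel check 6/7 of the site certificate inequalities for `ℤ^5` at the cell `0.2505`

Cell `prim-pcint`, seat `prim-pcint-1` (gen 17); memo `run/shared/lean/prim/pcint/T-FIBRE-ROUTE.md` §PHASE 9.
Instance `Z5RS`: `d = 5 = 3 + 2` (`k = 3` time axes, the transverse plane), SITE percolation, reach-3 pieces,
7-point law `A/DA = [12, 30, 100, 716, 100, 30, 12]/1000`, horizon `N = 150` (window half-width `60`), Fourier tail (cut-off data,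
`θ₀ = 1/2`) `T = 1250713447/10^12`, cell `p = 2505/10^4`. One `decide +kernel` per
representative (kernel memory), bit-mask site functional `BSMR.certFastMS`.
-/

namespace Summit.CriticalPhenomena.PercolationContinuityZ3.Theorems.Pcint.BSMR.Z5RS

open Summit.CriticalPhenomena.PercolationContinuityZ3.Theorems.Pcint.BSMR Summit.CriticalPhenomena.PercolationContinuityZ3.Theorems.Pcint.BSMX Summit.CriticalPhenomena.PercolationContinuityZ3.Theorems.Pcint.BSM

set_option maxHeartbeats 0 in
set_option maxRecDepth 65536 in
/-- The site certificate inequality at `![3, 1]` (cell `0.2505`). -/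
theorem hrep_6a : ∀ y ∈ [(![3, 1] : Fin 2 → ℤ)], certFastMS RS 3 10000 2505 7 V0t V1t (tr2 y) (shOfV (tr2 y)) ≤ Φn y * (2505 ^ 7 * 3 * 60000000 ^ 2 * (1000000000000 * 1)) := by
  decide +kernel

set_option maxHeartbeats 0 in
set_option maxRecDepth 65536 in
/-- The site certificate inequality at `![3, 0]` (cell `0.2505`). -/
theorem hrep_6b : ∀ y ∈ [(![3, 0] : Fin 2 → ℤ)], certFastMS RS 3 10000 2505 7 V0t V1t (tr2 y) (shOfV (tr2 y)) ≤ Φn y * (2505 ^ 7 * 3 * 60000000 ^ 2 * (1000000000000 * 1)) := by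
  decide +kernel

set_option maxHeartbeats 0 in
set_option maxRecDepth 65536 in
/-- The site certificate inequality at `![2, 2]` (cell `0.2505`). -/
theorem hrep_6c : ∀ y ∈ [(![2, 2] : Fin 2 → ℤ)], certFastMS RS 3 10000 2505 7 V0t V1t (tr2 y) (shOfV (tr2 y)) ≤ Φn y * (2505 ^ 7 * 3 * 60000000 ^ 2 * (1000000000000 * 1)) := by
  decide +kernel

set_option maxHeartbeats 0 in
set_option maxRecDepth 65536 in
/-- The site certificate inequality at `![2, 1]` (cell `0.2505`). -/
theorem hrep_6d : ∀ y ∈ [(![2, 1] : Fin 2 → ℤ)], certFastMS RS 3 10000 2505 7 V0t V1t (tr2 y) (shOfV (tr2 y)) ≤ Φn y * (2505 ^ 7 * 3 * 60000000 ^ 2 * (1000000000000 * 1)) := by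
  decide +kernel

/-- The site certificate inequalities on the offsets `((reps6.drop 20).take 4)` (cell `0.2505`). -/
theorem hrep_6 : ∀ y ∈ ((reps6.drop 20).take 4), certFastMS RS 3 10000 2505 7 V0t V1t (tr2 y) (shOfV (tr2 y)) ≤ Φn y * (2505 ^ 7 * 3 * 60000000 ^ 2 * (1000000000000 * 1)) := by
  intro y hy
  have hl : ((reps6.drop 20).take 4) = [(![3, 1] : Fin 2 → ℤ), (![3, 0] : Fin 2 → ℤ), (![2, 2] : Fin 2 → ℤ), (![2, 1] : Fin 2 → ℤ)] := by decide +kernel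
  rw [hl] at hy
  simp only [List.mem_cons, List.not_mem_nil, or_false] at hy
  rcases hy with rfl | rfl | rfl | rfl
  · exact hrep_6a _ (List.mem_singleton.2 rfl)
  · exact hrep_6b _ (List.mem_singleton.2 rfl)
  · exact hrep_6c _ (List.mem_singleton.2 rfl)
  · exact hrep_6d _ (List.mem_singleton.2 rfl)

end Summit.CriticalPhenomena.PercolationContinuityZ3.Theorems.Pcint.BSMR.Z5RS
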